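import Literature.Analysis.FluidPDE.NSLerayHopfNonUniqueness
import HarnessLib

/-!
# Non-uniqueness of Leray–Hopf solutions of the unforced Navier–Stokes equations on `ℝ³`
  (Hou–Wang–Yang 2025, computer-assisted — an unrefereed claim)

Status companion of **ns.S19** (`Literature.Analysis.FluidPDE.LerayHopfNonUniqueness` in `NSLerayHopf.lean`:
the negative answer to Buckmaster–Vicol 2019, EMS Surv. Math. Sci. 6, §8, Problem 9 — "Are the solutions to
the initial value problem for the Navier–Stokes equation unique in the class of Leray–Hopf weak solutions?",
Ladyzhenskaya's conjecture, the Jia–Šverák programme). That file records the problem as **open**, which is the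
state of the refereed literature the tree vendors (2019–2022: only the *forced* problem is settled,
Albritton–Brué–Colombo 2022, in-tree `albritton_brue_colombo`). In September 2025 a computer-assisted proof of
non-uniqueness for the **unforced** problem on `ℝ³` was announced:

* T. Y. Hou, Y. Wang, C. Yang, *Nonuniqueness of Leray–Hopf solutions to the unforced incompressible 3D
  Navier–Stokes Equation*, preprint arXiv:2509.25116 (2025), **Thm. 1**

(already mentioned, for the record only, in the module docstring of `NSLerayHopfNonUniqueness.lean`). This file
renders the CONTENT of that theorem in the vocabulary of `NSLerayHopf.lean` as a predicate
`HouWangYang2025.IsNonuniqueFamily u₀ U` on a datum `u₀` and a sequence of fields `U : ℕ → (ℝ → ℝ³ → ℝ³)` —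
Thm. 1 reads `∃ u₀ U, HouWangYang2025.IsNonuniqueFamily u₀ U` — and proves what follows from it. Being an
unrefereed (computer-assisted) claim, the existence statement itself is deliberately NOT minted as a named fact
`def … : Prop` (it has no `[cite]`-able refereed source, and a proving seat may not grow the base of unproved
facts, D-0026); nothing is asserted, every consequence carries the family as an explicit hypothesis
`(h : HouWangYang2025.IsNonuniqueFamily u₀ U)`:

* `HouWangYang2025.IsNonuniqueFamily.two_distinct` — the two-solution form on the printed interval `[0, 1]`
  (projection);
* `HouWangYang2025.IsNonuniqueFamily.pairwise_not_uncurry_ae_eq` — the members of the family are pairwise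
  distinct also as space–time fields on `(0, 1) × ℝ³` (the distinctness notion of `EnergyClassNonUniqueness`),
  by the finite-interval slice-pinning lemmas `IsLerayHopfOn.ae_eq_of_ae_forall_ae_eq` /
  `IsLerayHopfOn.ae_eq_of_uncurry_ae_eq` proved here (general `E`, mixed data);
* `LerayHopfNonUniqueness.of_isLerayHopfOn` — the general reduction of the global statement ns.S19 to
  local-in-time non-uniqueness on some `[0, T]` plus the (standard, here hypothesised) continuation of
  Leray–Hopf solutions past `T`; `HouWangYang2025.IsNonuniqueFamily.lerayHopfNonUniqueness` /
  `….energyClassNonUniqueness` — its instances for the family, the second through the in-tree implication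
  `LerayHopfNonUniqueness → EnergyClassNonUniqueness` of `NSLerayHopfNonUniqueness.lean`
  (`energyClassNonUniqueness_of_lerayHopfNonUniqueness`; not re-proved here).

## The printed result and its architecture (Hou–Wang–Yang 2025)

**Thm. 1** (verbatim up to notation; the system (1.1) is `∂ₜu + u·∇u − Δu + ∇p = 0`, `div u = 0` on `ℝ³`,
viscosity `1`, no force): *"There exist infinitely many distinct suitable Leray–Hopf solutions to the
Navier–Stokes equation (1.1) on `ℝ³ × [0, 1]` with the same divergence-free initial condition `u_in = u_loc` of
compact support, with `u_loc ∈ L^q` for any `q < 3` (in particular `u_in ∈ L²`). The solutions are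
`L^s([0, 1]; L^q(ℝ³))` for any `q ≥ 2`, `3/q + 2/s > 1`."* (Def. 1 there is Sohr's notion of Leray–Hopf solution:
`u ∈ L^∞_loc([0,T); L²_σ) ∩ L²_loc([0,T); H¹_σ)`, the weak formulation with datum, the energy inequality from `0`;
Remark 1: "suitable" means the local energy inequality (1.3),
`(∂ₜ − Δ) ½|u|² + |∇u|² + div((½|u|² + p) u) ≤ 0` in the sense of distributions.)

Architecture of the printed proof (§§1.3–1.4 and §2):
1. **Thm. 2** (computer-assisted): a smooth self-similar profile `Ũ`, with far-field behaviour `|ξ|⁻¹ A(ξ/|ξ|)`,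
   solving the stationary Navier–Stokes system in similarity variables *exactly*, whose linearisation `L_Ũ` has an
   eigenvalue of positive real part. Existence of `Ũ` near a high-precision numerical candidate `Ū`, and of the
   unstable eigenpair, is certified by splitting the linearised operator into a coercive part plus a compact
   perturbation, approximating the latter by a finite-rank operator with a rigorous error bound, and verifying
   invertibility on the finite-rank image by interval arithmetic.
2. §2.1 (Props. 3–4): smoothness and `O(|ξ|^{-3/2})` decay of the `H¹` correction, so that
   `ũ(x, t) = t^{-1/2} Ũ(x/√t)` is a self-similar solution with homogeneous (infinite-energy) datum.
3. §2.2: the Jia–Šverák localisation — `u_in = u_loc + w` by a Bogovskiĭ decomposition (`u_loc` compactly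
   supported and divergence free, `w = 0` near the origin), `u^cut = −e^{tΔ} w`, ansatz `u = ũ + u^cut + u^cor`;
   `U^cor` is a Duhamel fixed point in similarity time `τ = log t ∈ (−∞, 0]` for the stable/unstable splitting of
   `e^{τ L_Ũ}` by Riesz projections (Jia–Šverák 2015, Thm. 4.1; Albritton–Brué–Colombo 2022, §4). Every
   sufficiently small prescription of the unstable projections at `τ = 0` (`t = 1`) gives a solution; different
   prescriptions give solutions which differ at `t = 1`; all have the datum `u_loc ∈ L²` (`‖u(t) − u_loc‖₂ → 0`,
   (2.26)), are smooth for `0 < t ≤ 1` and hence suitable, with local energy *equality* ("as in [ABC22]"); the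
   `L^s_t L^q_x` bounds follow from `‖u(t)‖_q ≲ t^{3/(2q) − 1/(2(1−ε/3))} + 1`.

## Rendering (what the Lean statement keeps, and what it drops)

* "Leray–Hopf solution on `ℝ³ × [0, 1]` with datum `u_loc`" ↦ the accepted strict-sense
  `IsLerayHopfOn 1 1 0 u₀` (`LerayHopf.lean`: weak formulation with datum, `L^∞_t L²_x`, every slice in `L²`,
  weak gradient in `L²_{t,x}`, energy inequality from `0` for every `t ∈ [0, 1]` and from a.e. `s`, weak `L²`
  continuity on `(0, 1]`, strong attainment of the datum). This is the same reading as the tree's rendering of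
  Albritton–Brué–Colombo 2022, Thm. 1.2 by `albritton_brue_colombo`: the printed solutions are smooth
  finite-energy solutions on `(0, 1]` attaining `u_loc` strongly in `L²` ((2.26)), so they satisfy the energy
  equality on every `[s, t] ⊆ (0, 1]` and, letting `s → 0⁺`, from `0`; weak continuity is stated after Def. 1;
  the slice at `t = 0` may be taken to be `u_loc`.
* "suitable" ↦ for some pressure `p`, the accepted Caffarelli–Kohn–Nirenberg predicate
  `IsSuitableWeakSolutionOn (slab ℝ³ (Ioo 0 1) isOpen_Ioo) 1 0 (U n) p` on the OPEN slab `(0, 1) × ℝ³`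
  (`SuitableWeak.lean`: distributional solution with pressure, `L^∞_t L²_x ∩ L²_t H¹_x` and `p ∈ L^{3/2}`
  locally on the slab, local energy inequality (1.3) = CKN (2.5) against nonnegative `C_c^∞((0,1) × ℝ³)` tests).
  All its clauses are local on the open slab, where the printed solutions and their pressure are smooth, and the
  local energy inequality is the printed suitability (Remark 1, with equality by §2.2).
* **Dropped** (the predicate asks less than printed): smoothness for `t > 0`; the exponent `q = ∞` in the mixed-norm
  clause; exponents `s < 1`.
* "infinitely many distinct" ↦ a sequence `U : ℕ → (ℝ → ℝ³ → ℝ³)` of solutions which are pairwise distinct as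
  Leray–Hopf solutions: for `m ≠ n` some slice `t ∈ (0, 1]` has `U m t ≠ U n t` on a set of positive measure
  (the printed solutions differ at `t = 1`; the slice `t = 0` is never compared, cf. the design notes of
  `NSLerayHopf.lean`). By `…​.pairwise_not_uncurry_ae_eq` it implies pairwise distinctness a.e. in
  space–time on `(0, 1) × ℝ³`.
* "There exist `u_loc` and infinitely many solutions" ↦ NOT rendered as a closed `Prop` (see above): the
  predicate `IsNonuniqueFamily u₀ U` is what Thm. 1 asserts to be inhabited; no inhabitant can be produced here.
* Viscosity `ν = 1` and the time interval `[0, 1]` exactly as printed (no rescaling is performed here).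
* `u_loc ∈ L^q for any q < 3` ↦ `MemLp u₀ q volume` for `1 ≤ q < 3`; compact support ↦ `HasCompactSupport u₀`;
  "divergence-free" (for an `L²` field with a `|x|⁻¹` singularity) ↦ the accepted `IsWeaklyDivFree u₀`.

## What is NOT here

* No named fact and no proof of Thm. 1 (computer-assisted, unrefereed as of 2026-08). Proving
  `∃ u₀ U, IsNonuniqueFamily u₀ U` — equivalently settling ns.S19 in Lean — would need all of 1.–3. above
  (validated numerics with interval arithmetic, spectral theory of the non-self-adjoint operator `L_Ũ` on `L²_σ`,
  Navier–Stokes perturbation theory in similarity variables, Leray–Hopf theory on `ℝ³`), none of which Mathlib or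
  the tree has; `LerayHopfNonUniqueness` therefore stays an undischarged named statement.
* The continuation of a Leray–Hopf solution on `[0, T]` to a GLOBAL one (Leray's existence theorem from the
  slice `u(T)`, in-tree named fact `leray_existence_R3`, plus concatenation — "It is elementary to extend the
  distinct solutions to global-in-time Leray–Hopf solutions", Albritton–Brué–Colombo 2022, sentence after
  Thm. 1.2) is not formalised; it enters the reductions as the explicit hypothesis `hext`.
* The implication `LerayHopfNonUniqueness → EnergyClassNonUniqueness` and the global slice-pinning lemmas live in
  `NSLerayHopfNonUniqueness.lean` and are only used here.
* Buckmaster–Vicol's Problem 9 is posed on `𝕋³`; Hou–Wang–Yang work on `ℝ³`. Nothing is recorded for `𝕋³`.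

## References

* T. Y. Hou, Y. Wang, C. Yang, *Nonuniqueness of Leray–Hopf solutions to the unforced incompressible 3D
  Navier–Stokes Equation*, arXiv:2509.25116 (2025), Thm. 1, Remark 1, Thm. 2, Def. 1, §2.
* T. Buckmaster, V. Vicol, *Convex integration and phenomenologies in turbulence*, EMS Surv. Math. Sci. 6
  (2019), §3 (Defs. 3.4–3.5) and §8, Problem 9.
* H. Jia, V. Šverák, *Are the incompressible 3d Navier–Stokes equations locally ill-posed in the natural energy
  space?*, J. Funct. Anal. 268 (2015), Thm. 4.1.
* D. Albritton, E. Brué, M. Colombo, *Non-uniqueness of Leray solutions of the forced Navier–Stokes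
  equations*, Ann. of Math. 196 (2022), Def. 1.1, Thm. 1.2 and the sentence following it, §4.
* L. Caffarelli, R. Kohn, L. Nirenberg, CPAM 35 (1982), (2.1)–(2.5) (suitable weak solutions).
-/

noncomputable section

open MeasureTheory TopologicalSpace Set Function Filter Topology
open scoped InnerProductSpace RealInnerProductSpace ENNReal NNReal

namespace Literature.Analysis.FluidPDE

/-! ### Slice pinning on a finite time interval -/

section SlicePinning

variable {X : Type*} [MeasureSpace X] [SFinite (volume : Measure X)] {F : Type*}

/-- **Fubini for space–time a.e. equality over an arbitrary set of times.** If two time-dependent fields agree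
a.e. on `S × X` (product measure restricted to the slab over `S ⊆ ℝ`), then for a.e. `t ∈ S` their slices agree
a.e. in space. Generalises `ae_restrict_Ioi_slice_ae_eq_of_uncurry_ae_eq` (`NSLerayHopfNonUniqueness.lean`,
the case `S = (0, ∞)`) to any time set, e.g. the printed interval `(0, 1)`; same proof
(`Measure.ae_ae_of_ae_prod` for `vol|_{S × X} = (vol|_S) ⊗ vol`). [folklore] -/
theorem ae_restrict_slice_ae_eq_of_uncurry_ae_eq (S : Set ℝ) {u v : ℝ → X → F}
    (h : uncurry u =ᵐ[volume.restrict (S ×ˢ (univ : Set X))] uncurry v) :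
    ∀ᵐ t ∂(volume.restrict S), u t =ᵐ[volume] v t := by
  have hμ : (volume.restrict (S ×ˢ (univ : Set X)) : Measure (ℝ × X)) =
      (volume.restrict S).prod (volume : Measure X) := by
    rw [Measure.volume_eq_prod, ← Measure.restrict_univ (μ := (volume : Measure X)),
      Measure.prod_restrict, Measure.restrict_univ]
  rw [EventuallyEq, hμ] at h
  filter_upwards [Measure.ae_ae_of_ae_prod h] with t ht
  filter_upwards [ht] with x hx
  exact hx

variable {E : Type*} [NormedAddCommGroup E] [InnerProductSpace ℝ E] [FiniteDimensional ℝ E]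
  [MeasurableSpace E] [BorelSpace E]
variable {T ν ν' : ℝ} {f f' u v : ℝ → E → E} {u₀ u₀' : E → E}

/-- **Positive slices are pinned (finite interval, mixed data).** If two strict-sense Leray–Hopf solutions
`u`, `v` on `[0, T)`, `T > 0` — with arbitrary viscosities, forces and data — agree a.e. in space at a.e. time
`t ∈ (0, T)`, then their final slices agree a.e.: `u T = v T` a.e. For every `w ∈ L²` the pairings
`t ↦ ∫ ⟪u t, w⟫`, `t ↦ ∫ ⟪v t, w⟫` are continuous on `(0, T]` (weak-continuity clause, Leray 1934, §31) and agree
a.e. on `(0, T]`, hence at `T` (`Measure.eqOn_Ioc_of_ae_eq`); testing with `w = u T - v T ∈ L²` (clause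
`memLp`) gives `∫ ‖u T - v T‖² = 0`. Finite-interval, mixed-data companion of
`IsGlobalLerayHopf.ae_eq_slice_of_uncurry_ae_eq` (`NSLerayHopfNonUniqueness.lean`, global solutions of one
problem, du Bois-Reymond instead of the `L²` test), recorded for local-in-time statements such as
Hou–Wang–Yang's interval `[0, 1]`; it is the remark "every positive slice is pinned by weak `L²` continuity"
of the design notes of `NSLerayHopf.lean`. [folklore] -/
theorem IsLerayHopfOn.ae_eq_of_ae_forall_ae_eq (hu : IsLerayHopfOn T ν f u₀ u)
    (hv : IsLerayHopfOn T ν' f' u₀' v) (hT : 0 < T)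
    (h : ∀ᵐ t ∂(volume.restrict (Ioo 0 T)), u t =ᵐ[volume] v t) : u T =ᵐ[volume] v T := by
  -- the pairings with `w ∈ L²` agree at the final time
  have key : ∀ w : E → E, MemLp w 2 volume → ∫ x, ⟪u T x, w x⟫ = ∫ x, ⟪v T x, w x⟫ := by
    intro w hw
    have hae : (fun t => ∫ x, ⟪u t x, w x⟫) =ᵐ[volume.restrict (Ioc 0 T)]
        fun t => ∫ x, ⟪v t x, w x⟫ := by
      rw [← Measure.restrict_congr_set (Ioo_ae_eq_Ioc (μ := (volume : Measure ℝ)))]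
      filter_upwards [h] with t ht
      exact integral_congr_ae (by filter_upwards [ht] with x hx; rw [hx])
    exact Measure.eqOn_Ioc_of_ae_eq (μ := (volume : Measure ℝ)) hae (hu.weak_continuous w hw).1
      (hv.weak_continuous w hw).1 ⟨hT, le_rfl⟩
  -- test against `w = u T - v T`
  have huT : MemLp (u T) 2 volume := hu.memLp T ⟨hT.le, le_rfl⟩
  have hvT : MemLp (v T) 2 volume := hv.memLp T ⟨hT.le, le_rfl⟩
  set w : E → E := fun x => u T x - v T x with hw_def
  have hw : MemLp w 2 volume := huT.sub hvT
  have h0 : ∫ x, ‖w x‖ ^ 2 = 0 := by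
    have h1 : ∫ x, ⟪w x, w x⟫ = 0 := by
      simp_rw [hw_def, inner_sub_left]
      rw [integral_sub (integrable_inner_of_memLp_two huT hw) (integrable_inner_of_memLp_two hvT hw),
        key w hw, sub_self]
    simpa only [real_inner_self_eq_norm_sq] using h1
  have hae0 : (fun x => ‖w x‖ ^ 2) =ᵐ[volume] 0 :=
    (integral_eq_zero_iff_of_nonneg (fun x => sq_nonneg _) (hw.integrable_norm_pow two_ne_zero)).1 h0
  filter_upwards [hae0] with x hx
  have hx' : ‖w x‖ = 0 := by simpa using hx
  exact sub_eq_zero.1 (norm_eq_zero.1 hx')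

/-- **Space–time a.e. equality on `(0, T) × E` pins every slice in `(0, T]`.** If two strict-sense Leray–Hopf
solutions on `[0, T)` (mixed data allowed) agree a.e. on the open slab `(0, T) × E`, then `u t = v t` a.e. for
every `t ∈ (0, T]`: Fubini (`ae_restrict_slice_ae_eq_of_uncurry_ae_eq`) and
`IsLerayHopfOn.ae_eq_of_ae_forall_ae_eq` for the restrictions to `[0, t)` (`IsLerayHopfOn.of_le`). [folklore] -/
theorem IsLerayHopfOn.ae_eq_of_uncurry_ae_eq (hu : IsLerayHopfOn T ν f u₀ u)
    (hv : IsLerayHopfOn T ν' f' u₀' v)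
    (h : uncurry u =ᵐ[volume.restrict (Ioo 0 T ×ˢ (univ : Set E))] uncurry v) {t : ℝ}
    (ht : t ∈ Ioc 0 T) : u t =ᵐ[volume] v t :=
  (hu.of_le ht.2).ae_eq_of_ae_forall_ae_eq (hv.of_le ht.2) ht.1
    (ae_restrict_of_ae_restrict_of_subset (Ioo_subset_Ioo_right ht.2)
      (ae_restrict_slice_ae_eq_of_uncurry_ae_eq (Ioo 0 T) h))

end SlicePinning

/-! ### The claim and its consequences on `ℝ³` -/

/-- Local notation for physical space `ℝ³ = EuclideanSpace ℝ (Fin 3)`. -/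
local notation "ℝ³" => EuclideanSpace ℝ (Fin 3)

/-- **Reduction of ns.S19 to local-in-time non-uniqueness.** The in-tree global formulation
`LerayHopfNonUniqueness` (two distinct *global* Leray–Hopf solutions of the unforced Cauchy problem from one
`L²` datum, some viscosity `ν > 0`) follows from non-uniqueness on a finite interval — two strict-sense
Leray–Hopf solutions `u`, `v` on `ℝ³ × [0, T]` with viscosity `ν > 0`, zero force and the same weakly
divergence-free datum `u₀ ∈ L²`, differing on a set of positive measure at some `t ∈ (0, T]` (the printed shape
of the non-uniqueness theorems: Albritton–Brué–Colombo 2022, Thm. 1.2 for the forced system; Hou–Wang–Yang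
2025, Thm. 1, claimed, for the unforced one) — together with the continuation of Leray–Hopf solutions past `T`:
every Leray–Hopf solution on `[0, T]` from `u₀` agrees on `(0, T]` with a global one (Leray's existence theorem
from the slice `u(T)` and concatenation; "It is elementary to extend the distinct solutions to global-in-time
Leray–Hopf solutions … using Leray's result", Albritton–Brué–Colombo 2022, after Thm. 1.2). The continuation is
the explicit hypothesis `hext` (not formalised in the tree); with it, `u` and `v` extend to global solutions
which still differ at the time `t`. [folklore] -/
theorem LerayHopfNonUniqueness.of_isLerayHopfOn {T ν : ℝ} (hν : 0 < ν) {u₀ : ℝ³ → ℝ³}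
    {u v : ℝ → ℝ³ → ℝ³} (hu₀ : MemLp u₀ 2 volume) (hdiv : IsWeaklyDivFree u₀)
    (hu : IsLerayHopfOn T ν 0 u₀ u) (hv : IsLerayHopfOn T ν 0 u₀ v)
    (hne : ∃ t ∈ Ioc 0 T, ¬ (u t =ᵐ[volume] v t))
    (hext : ∀ u : ℝ → ℝ³ → ℝ³, IsLerayHopfOn T ν 0 u₀ u →
      ∃ w : ℝ → ℝ³ → ℝ³, IsGlobalLerayHopf ν 0 u₀ w ∧ ∀ t ∈ Ioc 0 T, w t = u t) :
    LerayHopfNonUniqueness := by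
  obtain ⟨t, ht, hne⟩ := hne
  obtain ⟨w₀, hw₀, hw₀eq⟩ := hext u hu
  obtain ⟨w₁, hw₁, hw₁eq⟩ := hext v hv
  refine ⟨ν, hν, u₀, hu₀, hdiv, w₀, w₁, hw₀, hw₁, t, ht.1, ?_⟩
  rw [hw₀eq t ht, hw₁eq t ht]
  exact hne

namespace HouWangYang2025

/-- **The object of Hou–Wang–Yang 2025, Thm. 1** (non-uniqueness of Leray–Hopf weak solutions of the
*unforced* Navier–Stokes equations on `ℝ³`; computer-assisted proof, preprint arXiv:2509.25116 — an unrefereed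
claim). `IsNonuniqueFamily u₀ U` says that the datum `u₀ : ℝ³ → ℝ³` and the sequence of fields
`U : ℕ → (ℝ → ℝ³ → ℝ³)` are as Thm. 1 asserts to exist: `u₀ ∈ L²(ℝ³)` (the printed `u_loc`) is compactly
supported, weakly divergence free and lies in `L^q(ℝ³)` for every `1 ≤ q < 3`; every `U n` is a Leray–Hopf weak
solution of the Navier–Stokes system with viscosity `1` and zero force on `ℝ³ × [0, 1]` with datum `u₀`, and is
**suitable** — a suitable weak solution on the open slab `(0, 1) × ℝ³` for some pressure (local energy
inequality (1.3), Remark 1); each `U n` lies in `L^s(0, 1; L^q(ℝ³))` whenever `2 ≤ q < ∞`, `1 ≤ s ≤ ∞` and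
`3/q + 2/s > 1` (mixed norm `MemLqLp s q`, time exponent first); and the `U n` are pairwise distinct: for `m ≠ n`
there is a time `t ∈ (0, 1]` with `U m t ≠ U n t` on a set of positive measure. **Thm. 1 is the statement
`∃ u₀ U, IsNonuniqueFamily u₀ U`**, deliberately not minted as a named fact (unrefereed claim; module
docstring) — nothing is asserted here. Rendering: "Leray–Hopf" is the accepted strict-sense `IsLerayHopfOn` (as
for `albritton_brue_colombo`), "suitable" the accepted `IsSuitableWeakSolutionOn` on `slab ℝ³ (Ioo 0 1)`;
smoothness for `t > 0`, printed in §2.2, is dropped; `ν = 1` and `[0, 1]` as printed — see the module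
docstring. [claim: HouWangYang2025, status: under-review] -/
def IsNonuniqueFamily (u₀ : ℝ³ → ℝ³) (U : ℕ → ℝ → ℝ³ → ℝ³) : Prop :=
  MemLp u₀ 2 volume ∧ HasCompactSupport u₀ ∧ IsWeaklyDivFree u₀ ∧
    (∀ q : ℝ≥0∞, 1 ≤ q → q < 3 → MemLp u₀ q volume) ∧
    (∀ n, IsLerayHopfOn 1 1 0 u₀ (U n) ∧
      ∃ p : ℝ → ℝ³ → ℝ, IsSuitableWeakSolutionOn (slab ℝ³ (Ioo 0 1) isOpen_Ioo) 1 0 (U n) p) ∧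
    (∀ (n : ℕ) (q s : ℝ≥0∞), 2 ≤ q → q ≠ ∞ → 1 ≤ s → 1 < 3 / q + 2 / s →
      MemLqLp s q (U n) (Ioo 0 1)) ∧
    ∀ m n : ℕ, m ≠ n → ∃ t ∈ Ioc (0 : ℝ) 1, ¬ (U m t =ᵐ[volume] U n t)

variable {u₀ : ℝ³ → ℝ³} {U : ℕ → ℝ → ℝ³ → ℝ³}

/-- Every member of a Hou–Wang–Yang family is a (strict-sense) Leray–Hopf weak solution on `ℝ³ × [0, 1]` with
viscosity `1`, zero force and datum `u₀` (projection). [folklore] -/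
theorem IsNonuniqueFamily.isLerayHopfOn (h : IsNonuniqueFamily u₀ U) (n : ℕ) :
    IsLerayHopfOn 1 1 0 u₀ (U n) :=
  (h.2.2.2.2.1 n).1

/-- Every member of a Hou–Wang–Yang family is a suitable weak solution on the open slab `(0, 1) × ℝ³` for some
pressure (projection; Hou–Wang–Yang 2025, Remark 1). [folklore] -/
theorem IsNonuniqueFamily.exists_isSuitableWeakSolutionOn (h : IsNonuniqueFamily u₀ U) (n : ℕ) :
    ∃ p : ℝ → ℝ³ → ℝ, IsSuitableWeakSolutionOn (slab ℝ³ (Ioo 0 1) isOpen_Ioo) 1 0 (U n) p :=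
  (h.2.2.2.2.1 n).2

/-- **Two distinct Leray–Hopf solutions on `[0, 1]`** — the shape of ns.S19 on the printed time interval: a
Hou–Wang–Yang family provides two Leray–Hopf weak solutions `u`, `v` of the unforced system with viscosity `1`
on `ℝ³ × [0, 1]`, both with the compactly supported, weakly divergence-free datum `u₀ ∈ L²(ℝ³)`, and a time
`t ∈ (0, 1]` at which `u t ≠ v t` on a set of positive measure. Real proof: the members `U 0`, `U 1`
(projection; suitability and the mixed-norm bounds are forgotten). [folklore] -/
theorem IsNonuniqueFamily.two_distinct (h : IsNonuniqueFamily u₀ U) :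
    MemLp u₀ 2 volume ∧ HasCompactSupport u₀ ∧ IsWeaklyDivFree u₀ ∧
      ∃ u v : ℝ → ℝ³ → ℝ³, IsLerayHopfOn 1 1 0 u₀ u ∧ IsLerayHopfOn 1 1 0 u₀ v ∧
        ∃ t ∈ Ioc (0 : ℝ) 1, ¬ (u t =ᵐ[volume] v t) := by
  obtain ⟨hu₀, hcs, hdiv, -, hU, -, hdist⟩ := h
  exact ⟨hu₀, hcs, hdiv, U 0, U 1, (hU 0).1, (hU 1).1, hdist 0 1 zero_ne_one⟩

/-- **A Hou–Wang–Yang family is pairwise distinct a.e. in space–time.** The members `U m`, `U n`, `m ≠ n`, are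
not a.e. equal on the open slab `(0, 1) × ℝ³` — the distinctness notion of `EnergyClassNonUniqueness` —
because space–time a.e. equality of two Leray–Hopf solutions on `[0, 1)` would pin every slice in `(0, 1]`
(`IsLerayHopfOn.ae_eq_of_uncurry_ae_eq`), contradicting slice-wise distinctness. Real proof. [folklore] -/
theorem IsNonuniqueFamily.pairwise_not_uncurry_ae_eq (h : IsNonuniqueFamily u₀ U) {m n : ℕ} (hmn : m ≠ n) :
    ¬ (uncurry (U m) =ᵐ[volume.restrict (Ioo (0 : ℝ) 1 ×ˢ (univ : Set ℝ³))] uncurry (U n)) := by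
  intro hae
  obtain ⟨t, ht, hne⟩ := h.2.2.2.2.2.2 m n hmn
  exact hne ((h.isLerayHopfOn m).ae_eq_of_uncurry_ae_eq (h.isLerayHopfOn n) hae ht)

/-- **Reduction of ns.S19 to the Hou–Wang–Yang claim.** Granted a Hou–Wang–Yang family and the continuation of
(strict-sense) Leray–Hopf solutions of the unforced system with viscosity `1` on `ℝ³ × [0, 1]` from the datum
`u₀` to global ones agreeing on `(0, 1]` (hypothesis `hext`, see `LerayHopfNonUniqueness.of_isLerayHopfOn`),
the global statement `LerayHopfNonUniqueness` holds, with `ν = 1` and the members `U 0`, `U 1` continued.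
[folklore] -/
theorem IsNonuniqueFamily.lerayHopfNonUniqueness (h : IsNonuniqueFamily u₀ U)
    (hext : ∀ u : ℝ → ℝ³ → ℝ³, IsLerayHopfOn 1 1 0 u₀ u →
      ∃ w : ℝ → ℝ³ → ℝ³, IsGlobalLerayHopf 1 0 u₀ w ∧ ∀ t ∈ Ioc (0 : ℝ) 1, w t = u t) :
    LerayHopfNonUniqueness :=
  LerayHopfNonUniqueness.of_isLerayHopfOn one_pos h.1 h.2.2.1 (h.isLerayHopfOn 0) (h.isLerayHopfOn 1)
    (h.2.2.2.2.2.2 0 1 zero_ne_one) hext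

/-- **Reduction of the energy-class variant `W_E` to the Hou–Wang–Yang claim**, under the same continuation
hypothesis: compose `IsNonuniqueFamily.lerayHopfNonUniqueness` with the in-tree implication
`energyClassNonUniqueness_of_lerayHopfNonUniqueness` (`NSLerayHopfNonUniqueness.lean`). [folklore] -/
theorem IsNonuniqueFamily.energyClassNonUniqueness (h : IsNonuniqueFamily u₀ U)
    (hext : ∀ u : ℝ → ℝ³ → ℝ³, IsLerayHopfOn 1 1 0 u₀ u →
      ∃ w : ℝ → ℝ³ → ℝ³, IsGlobalLerayHopf 1 0 u₀ w ∧ ∀ t ∈ Ioc (0 : ℝ) 1, w t = u t) :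
    EnergyClassNonUniqueness :=
  energyClassNonUniqueness_of_lerayHopfNonUniqueness (h.lerayHopfNonUniqueness hext)

end HouWangYang2025

end Literature.Analysis.FluidPDE
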